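import Summits.HodgeConjecture.HodgeConjecture.Theorems.F0P3cStCharTSOffStratumVal       -- ★ p849250 (this seat): `valuation_charpoly_coeff_shell_two`
import Literature.NumberTheory.Rogawski1990.LocalNormFibreSurjectiveNonsplit             -- ★ `charpoly_localNonsplitEquiv`
import Literature.NumberTheory.Rogawski1990.LocalTransfer                                -- ★ `IsLocalStablyConjH`
import HarnessLib

/-!
# F0 · P3c · line LH6 «StCharTS» — road (D) «DEEP-FL», brick D3-iii-H «OFF-STRATUM TEST, H-SIDE, ON THE CM CARRIERS»: if a class of `H(L⁺_v) = U(Φ₂) × U(Φ₁)` stably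
# conjugate to `γ_H = (h₂, h₁)` meets the rank-one deep shell `K₂ (z₂·a₂ᵐ) K₂` in the `U(Φ₂)`-component, then `|det h₂|_w < |tr h₂|_w²` (so ★ HYP puts `γ_H` ON the stratum)

Cell `pub/hodgecm-mathlib`, crux H413 = `stmt-HodgeConjecture-24833` (`--supports` lane, helper), route HCCMUnconditional; seat LH6-p04 (g2), road (D) owner;
status v3 `F0/P3b/LH6-p04/g2/ROAD-D.status.v3.txt` brick D3-iii (CM instantiation, `H`-side; twin of ★∕filed `F0P3cStCharTSOffStratumG`).  THEOREMS ONLY, sorry-free.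
HONEST LABEL: HC_CM is proved only modulo the 7 printed citations (2 remaining: hLiu418 = stmt-HodgeConjecture-24832, h413 = stmt-HodgeConjecture-24833) until
rung 0 closes; count-neutral.

CHAIN (all ★): §1 the rank-2 shell pattern through a hom `E : G →* GL₂(K)` (★ D3-iii-val `valuation_charpoly_coeff_shell_two` at `d = (βαᵐ, βα′ᵐ)`) · stable conjugacy
preserves `charpoly` (★ `IsStablyConj.charpoly_eq`) and so does conjugation (Mathlib `charpoly_units_conj`) · ★ `charpoly_localNonsplitEquiv` (`charpoly (E₂ g) =
(charpoly g).map eval_w`) · Mathlib `charpoly_fin_two`.  With `|β| = 1`: `|tr h₂|_w = |α|_w^{-m} > 1` and `|det h₂|_w = 1`. [Rogawski1990, §4.3 p. 42; §12.7 p. 195.]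

## References
* [Rogawski1990] J. D. Rogawski, *Automorphic Representations of Unitary Groups in Three Variables*, Ann. of Math. Stud. 123 (1990), §3.1 p. 19; §4.3 p. 42; §12.7 p. 195.
* [PlatonovRapinchuk1994] V. Platonov, A. Rapinchuk, *Algebraic Groups and Number Theory* (1994), §5.1 (the one-place model).
* [Casselman1995] W. Casselman, *Introduction to the theory of admissible representations of p-adic reductive groups* (1995 notes), Prop. 1.4.4, §1.5.
-/

set_option autoImplicit false
-- the mandated namespace has the single-problem summit's repeated segment (`HodgeConjecture.HodgeConjecture`)
set_option linter.dupNamespace false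

noncomputable section

open Matrix Polynomial NumberField IsDedekindDomain
open scoped MatrixGroups
open Literature.NumberTheory.Rogawski1990 Literature.NumberTheory.Automorphic Literature.NumberTheory.Automorphic.UnitaryGroup
open Literature.NumberTheory.GaloisRepresentations

namespace Summit.HodgeConjecture.HodgeConjecture.Cruxes.H413.F0P3cStCharTSOffStratumH

/-! ## §1 The rank-2 shell pattern through a hom `E : G →* GL₂(K)` -/

section Hom

variable {G : Type*} [Group G] {K : Type*} [Field K] {Γ₀ : Type*} [LinearOrderedCommGroupWithZero Γ₀] (v : Valuation K Γ₀)
  (E : G →* GL (Fin 2) K)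

/-- On the shell: `x ∈ K b K'` ⇒ `E x = E k₁ · E b · E k₂` for some `k₁ ∈ K`, `k₂ ∈ K'`. [folklore] -/
theorem exists_coe_eq_of_mem_doubleCoset (Kg Kg' : Subgroup G) (b : G) {x : G} (hx : x ∈ DoubleCoset.doubleCoset b (Kg : Set G) Kg') :
    ∃ k₁ ∈ Kg, ∃ k₂ ∈ Kg', ((E x : GL (Fin 2) K) : Matrix (Fin 2) (Fin 2) K) =
      ((E k₁ : GL (Fin 2) K) : Matrix (Fin 2) (Fin 2) K) * ((E b : GL (Fin 2) K) : Matrix (Fin 2) (Fin 2) K) * ((E k₂ : GL (Fin 2) K) : Matrix (Fin 2) (Fin 2) K) := by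
  obtain ⟨k₁, hk₁, k₂, hk₂, rfl⟩ := DoubleCoset.mem_doubleCoset.1 hx
  exact ⟨k₁, hk₁, k₂, hk₂, by rw [map_mul, map_mul, Units.val_mul, Units.val_mul]⟩

/-- `E(z·aᵐ) = diag(β·d₀ᵐ)` when `E z = β·1` and `E a = diag(d₀)`. [folklore] -/
theorem coe_central_mul_pow_eq_diagonal {z a : G} {β : K} {d₀ : Fin 2 → K} (hz : ((E z : GL (Fin 2) K) : Matrix (Fin 2) (Fin 2) K) = β • (1 : Matrix (Fin 2) (Fin 2) K))
    (ha : ((E a : GL (Fin 2) K) : Matrix (Fin 2) (Fin 2) K) = diagonal d₀) (m : ℕ) :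
    ((E (z * a ^ m) : GL (Fin 2) K) : Matrix (Fin 2) (Fin 2) K) = diagonal (fun i => β * d₀ i ^ m) := by
  rw [map_mul, Units.val_mul, map_pow, Units.val_pow_eq_pow_val, ha, diagonal_pow, hz, smul_mul_assoc, one_mul, smul_eq_diagonal_mul, diagonal_mul_diagonal]
  rfl

/-- **THE RANK-2 SHELL PATTERN THROUGH `E`.**  Let `K₂ ≤ G` be of LEVEL `r < 1` under `E`, `E z = β·1` with `v(β) ≠ 0`, `E a = diag(α, α′)` with `0 < v(α) < 1`,
`v(α)·v(α′) = 1`, `m ≥ 1`.  Then every `x ∈ K₂ (z aᵐ) K₂` has `v(coeff₁ charpoly (E x)) = v(β)·v(α′)ᵐ` and `v(coeff₀ …) = v(β)²` (★ D3-iii-val §1 at `d = (βαᵐ, βα′ᵐ)`).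
[cite: Rogawski1990, §12.7 L. 12.7.3 (proof) p. 195] [cite: Casselman1995, Prop. 1.4.4, §1.5] -/
theorem valuation_charpoly_coeff_of_mem_shell (Kn : Subgroup G) {r : Γ₀} (hr : r < 1)
    (hK : ∀ k ∈ Kn, ∀ i j, v (((E k : GL (Fin 2) K) : Matrix (Fin 2) (Fin 2) K) i j - (1 : Matrix (Fin 2) (Fin 2) K) i j) ≤ r)
    {z a : G} {β α α' : K} (hz : ((E z : GL (Fin 2) K) : Matrix (Fin 2) (Fin 2) K) = β • (1 : Matrix (Fin 2) (Fin 2) K))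
    (ha : ((E a : GL (Fin 2) K) : Matrix (Fin 2) (Fin 2) K) = diagonal ![α, α'])
    (hβ : v β ≠ 0) (hα0 : v α ≠ 0) (hα1 : v α < 1) (hαα' : v α * v α' = 1) {m : ℕ} (hm : 1 ≤ m)
    {x : G} (hx : x ∈ DoubleCoset.doubleCoset (z * a ^ m) (Kn : Set G) Kn) :
    v (((E x : GL (Fin 2) K) : Matrix (Fin 2) (Fin 2) K).charpoly.coeff 1) = v β * v α' ^ m ∧
      v (((E x : GL (Fin 2) K) : Matrix (Fin 2) (Fin 2) K).charpoly.coeff 0) = v β ^ 2 := by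
  obtain ⟨k₁, hk₁, k₂, hk₂, hxe⟩ := exists_coe_eq_of_mem_doubleCoset E Kn Kn (z * a ^ m) hx
  have hb := coe_central_mul_pow_eq_diagonal E hz ha m
  set d : Fin 2 → K := fun i => β * (![α, α'] i) ^ m with hd
  have hd0 : v (d 0) = v β * v α ^ m := by simp [hd, Valuation.map_mul, Valuation.map_pow]
  have hd1 : v (d 1) = v β * v α' ^ m := by simp [hd, Valuation.map_mul, Valuation.map_pow]
  have hαm : v α ^ m < 1 := pow_lt_one₀ zero_le hα1 (by omega)
  have hα'gt : 1 < v α' := by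
    by_contra hle
    rw [not_lt] at hle
    have : v α * v α' < 1 := by
      calc v α * v α' ≤ v α * 1 := mul_le_mul' le_rfl hle
        _ = v α := mul_one _
        _ < 1 := hα1
    rw [hαα'] at this
    exact lt_irrefl _ this
  have hα'm : 1 < v α' ^ m := one_lt_pow₀ hα'gt (by omega)
  have hβpos : 0 < v β := zero_lt_iff.2 hβ
  have h01 : v (d 0) < v (d 1) := by
    rw [hd0, hd1]
    calc v β * v α ^ m < v β * 1 := mul_lt_mul_of_pos_left hαm hβpos
      _ = v β := mul_one _
      _ < v β * v α' ^ m := by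
          calc v β = v β * 1 := (mul_one _).symm
            _ < v β * v α' ^ m := mul_lt_mul_of_pos_left hα'm hβpos
  have hd0ne : v (d 0) ≠ 0 := by
    rw [hd0]; exact mul_ne_zero hβ (pow_ne_zero m hα0)
  have hxd : ((E x : GL (Fin 2) K) : Matrix (Fin 2) (Fin 2) K) =
      ((E k₁ : GL (Fin 2) K) : Matrix (Fin 2) (Fin 2) K) * diagonal d * ((E k₂ : GL (Fin 2) K) : Matrix (Fin 2) (Fin 2) K) := by
    rw [hxe, hb]
  obtain ⟨h1, h0⟩ := F0P3cStCharTSOffStratumVal.valuation_charpoly_coeff_shell_two v d _ _ hr (hK k₁ hk₁) (hK k₂ hk₂) hd0ne h01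
  rw [hxd]
  refine ⟨?_, ?_⟩
  · rw [h1, hd1]
  · rw [h0, hd0, hd1]
    have : v α ^ m * v α' ^ m = 1 := by rw [← mul_pow, hαα', one_pow]
    calc v β * v α ^ m * (v β * v α' ^ m) = v β * v β * (v α ^ m * v α' ^ m) := by ac_rfl
      _ = v β ^ 2 := by rw [this, mul_one, pow_two]

/-- The coefficients of the characteristic polynomial of a `2 × 2` matrix: `coeff₁ = −tr`, `coeff₀ = det` (Mathlib `charpoly_fin_two`). [folklore] -/
theorem charpoly_fin_two_coeff {R : Type*} [CommRing R] [Nontrivial R] (M : Matrix (Fin 2) (Fin 2) R) :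
    M.charpoly.coeff 1 = -M.trace ∧ M.charpoly.coeff 0 = M.det := by
  rw [Matrix.charpoly_fin_two]
  simp only [coeff_sub, coeff_add, coeff_C_mul, coeff_X_pow, coeff_X, coeff_C]
  norm_num

/-- **PATTERN ⇒ `v(det) < v(tr)²` for a conjugate.**  If `charpoly N = charpoly (E x)` for some `x` on the shell (e.g. `N` stably conjugate to a shell element), and
`v(β) = 1`, then `v(det N) = 1 < v(tr N)²`. [cite: Rogawski1990, §12.7 L. 12.7.3 (proof) p. 195] -/
theorem valuation_det_lt_trace_sq_of_charpoly_eq (Kn : Subgroup G) {r : Γ₀} (hr : r < 1)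
    (hK : ∀ k ∈ Kn, ∀ i j, v (((E k : GL (Fin 2) K) : Matrix (Fin 2) (Fin 2) K) i j - (1 : Matrix (Fin 2) (Fin 2) K) i j) ≤ r)
    {z a : G} {β α α' : K} (hz : ((E z : GL (Fin 2) K) : Matrix (Fin 2) (Fin 2) K) = β • (1 : Matrix (Fin 2) (Fin 2) K))
    (ha : ((E a : GL (Fin 2) K) : Matrix (Fin 2) (Fin 2) K) = diagonal ![α, α'])
    (hβ : v β = 1) (hα0 : v α ≠ 0) (hα1 : v α < 1) (hαα' : v α * v α' = 1) {m : ℕ} (hm : 1 ≤ m)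
    {x : G} (hx : x ∈ DoubleCoset.doubleCoset (z * a ^ m) (Kn : Set G) Kn)
    {N : Matrix (Fin 2) (Fin 2) K} (hN : N.charpoly = ((E x : GL (Fin 2) K) : Matrix (Fin 2) (Fin 2) K).charpoly) :
    v N.det < v N.trace ^ 2 := by
  obtain ⟨h1, h0⟩ := valuation_charpoly_coeff_of_mem_shell v E Kn hr hK hz ha (by rw [hβ]; exact one_ne_zero) hα0 hα1 hαα' hm hx
  obtain ⟨hc1, hc0⟩ := charpoly_fin_two_coeff N
  rw [← hN, hc1, Valuation.map_neg, hβ, one_mul] at h1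
  rw [← hN, hc0, hβ, one_pow] at h0
  have hα'gt : 1 < v α' := by
    by_contra hle
    rw [not_lt] at hle
    have : v α * v α' < 1 := by
      calc v α * v α' ≤ v α * 1 := mul_le_mul' le_rfl hle
        _ = v α := mul_one _
        _ < 1 := hα1
    rw [hαα'] at this
    exact lt_irrefl _ this
  have hα'm : 1 < v α' ^ m := one_lt_pow₀ hα'gt (by omega)
  rw [h0, h1]
  calc (1 : Γ₀) < v α' ^ m := hα'm
    _ = v α' ^ m * 1 := (mul_one _).symm
    _ < v α' ^ m * v α' ^ m := mul_lt_mul_of_pos_left hα'm (lt_trans zero_lt_one hα'm)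
    _ = (v α' ^ m) ^ 2 := (pow_two _).symm

end Hom

/-! ## §2 The H-side off-stratum test on the CM carriers -/

section CM

variable (L : Type) [Field L] [NumberField L] [IsCMField L] (v : HeightOneSpectrum (𝓞 ↥(maximalRealSubfield L)))
  (w : PlacesOver L v) (hw : IsCMField.complexConj L • w.1 = w.1)

set_option maxHeartbeats 800000 in  -- statement-level `whnf` on the CM carriers
/-- **D3-iii-H «OFF-STRATUM TEST, H-SIDE».**  Notation: `U₂ = U(Φ₂)(L⁺_v)` (★ `cmDatum L 2 Φ₂`), `E₂ = localNonsplitEquiv` at `(w, hw)`, `σ_w = galAdicCompletionMap`.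
Data: a subgroup `K₂ ≤ U₂` of LEVEL `r < 1` under `E₂`; `z, a ∈ U₂` with `E₂ z = β·1`, `|β|_w = 1` (central `z`) and `E₂ a = diag(α, (σ_w α)⁻¹)` (the rank-one ray of
the endoscopic Iwahori datum), `0 < |α|_w < 1`, `m ≥ 1`; `γ_H, δ ∈ H_v = U₂ × U(Φ₁)_v` STABLY CONJUGATE (★ `IsLocalStablyConjH`) with a `U₂`-conjugate `y·δ.1·y⁻¹` of the
first component in the shell `K₂ (z aᵐ) K₂` — as happens for every class `[δ]` inside the stable class of `γ_H` meeting the `H`-shell `K_H (z aᵐ, z₁) K_H`.  Then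
`h₂ = γ_H.1`, read at `w`, satisfies `|det h₂|_w < |tr h₂|_w²` — the hypothesis of ★ HYP `exists_mem_unitaryGroup_eigenframe_of_valued_det_lt`.
[cite: Rogawski1990, §3.1 p. 19; §4.3 p. 42; §12.7 L. 12.7.3 (proof) p. 195] -/
theorem valued_det_lt_trace_sq_of_isLocalStablyConjH_of_conj_mem_shell
    (K₂ : Subgroup ((cmDatum L 2 (Matrix.of fun i j : Fin 2 => if i.val + j.val + 1 = 2 then (1 : L) else 0)).Local v)) {r : WithZero (Multiplicative ℤ)} (hr : r < 1)
    (hK : ∀ k ∈ K₂, ∀ i j, Valued.v ((((localNonsplitEquiv (IsCMField.complexConj L) (Matrix.of fun i j : Fin 2 => if i.val + j.val + 1 = 2 then (1 : L) else 0)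
        (IsCMField.complexConj_ne_one L) w hw k :
        ↥(unitaryGroupOfForm (galAdicCompletionMap (L := L) (IsCMField.complexConj L) hw) (placeForm (Matrix.of fun i j : Fin 2 => if i.val + j.val + 1 = 2 then (1 : L) else 0) w.1))) :
        GL (Fin 2) (w.1.adicCompletion L)) : Matrix (Fin 2) (Fin 2) (w.1.adicCompletion L)) i j - (1 : Matrix (Fin 2) (Fin 2) (w.1.adicCompletion L)) i j) ≤ r)
    {z a : (cmDatum L 2 (Matrix.of fun i j : Fin 2 => if i.val + j.val + 1 = 2 then (1 : L) else 0)).Local v} {β α : w.1.adicCompletion L}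
    (hz : (((localNonsplitEquiv (IsCMField.complexConj L) (Matrix.of fun i j : Fin 2 => if i.val + j.val + 1 = 2 then (1 : L) else 0) (IsCMField.complexConj_ne_one L) w hw z :
        ↥(unitaryGroupOfForm (galAdicCompletionMap (L := L) (IsCMField.complexConj L) hw) (placeForm (Matrix.of fun i j : Fin 2 => if i.val + j.val + 1 = 2 then (1 : L) else 0) w.1))) :
        GL (Fin 2) (w.1.adicCompletion L)) : Matrix (Fin 2) (Fin 2) (w.1.adicCompletion L)) = β • (1 : Matrix (Fin 2) (Fin 2) (w.1.adicCompletion L)))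
    (hβ : Valued.v β = 1)
    (ha : (((localNonsplitEquiv (IsCMField.complexConj L) (Matrix.of fun i j : Fin 2 => if i.val + j.val + 1 = 2 then (1 : L) else 0) (IsCMField.complexConj_ne_one L) w hw a :
        ↥(unitaryGroupOfForm (galAdicCompletionMap (L := L) (IsCMField.complexConj L) hw) (placeForm (Matrix.of fun i j : Fin 2 => if i.val + j.val + 1 = 2 then (1 : L) else 0) w.1))) :
        GL (Fin 2) (w.1.adicCompletion L)) : Matrix (Fin 2) (Fin 2) (w.1.adicCompletion L)) =
        Matrix.diagonal ![α, ((galAdicCompletionMap (L := L) (IsCMField.complexConj L) hw) α)⁻¹])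
    (hα0 : α ≠ 0) (hα1 : Valued.v α < 1) {m : ℕ} (hm : 1 ≤ m)
    (γH δ : (cmDatum L 2 (Matrix.of fun i j : Fin 2 => if i.val + j.val + 1 = 2 then (1 : L) else 0)).Local v ×
      (cmDatum L 1 (Matrix.of fun i j : Fin 1 => if i.val + j.val + 1 = 1 then (1 : L) else 0)).Local v)
    (hst : IsLocalStablyConjH L v γH δ)
    (y : (cmDatum L 2 (Matrix.of fun i j : Fin 2 => if i.val + j.val + 1 = 2 then (1 : L) else 0)).Local v)
    (hy : y * δ.1 * y⁻¹ ∈ DoubleCoset.doubleCoset (z * a ^ m)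
      (K₂ : Set ((cmDatum L 2 (Matrix.of fun i j : Fin 2 => if i.val + j.val + 1 = 2 then (1 : L) else 0)).Local v)) K₂) :
    Valued.v ((Pi.evalRingHom (fun w' : PlacesOver L v => w'.1.adicCompletion L) w) ((γH.1.val : GL (Fin 2) (LocalRing L v)) : Matrix (Fin 2) (Fin 2) (LocalRing L v)).det) <
      Valued.v ((Pi.evalRingHom (fun w' : PlacesOver L v => w'.1.adicCompletion L) w) ((γH.1.val : GL (Fin 2) (LocalRing L v)) : Matrix (Fin 2) (Fin 2) (LocalRing L v)).trace) ^ 2 := by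
  -- abbreviations
  set ev := Pi.evalRingHom (fun w' : PlacesOver L v => w'.1.adicCompletion L) w with hev
  set σw := galAdicCompletionMap (L := L) (IsCMField.complexConj L) hw with hσw
  -- the hom `E₂ : U₂ →* GL₂(L_w)`
  set E : (cmDatum L 2 (Matrix.of fun i j : Fin 2 => if i.val + j.val + 1 = 2 then (1 : L) else 0)).Local v →* GL (Fin 2) (w.1.adicCompletion L) :=
    (unitaryGroupOfForm σw (placeForm (Matrix.of fun i j : Fin 2 => if i.val + j.val + 1 = 2 then (1 : L) else 0) w.1)).subtype.comp
      (localNonsplitEquiv (IsCMField.complexConj L) (Matrix.of fun i j : Fin 2 => if i.val + j.val + 1 = 2 then (1 : L) else 0) (IsCMField.complexConj_ne_one L) w hw).toMonoidHom with hE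
  have hEapply : ∀ g, ((E g : GL (Fin 2) (w.1.adicCompletion L)) : Matrix (Fin 2) (Fin 2) (w.1.adicCompletion L)) =
      (((localNonsplitEquiv (IsCMField.complexConj L) (Matrix.of fun i j : Fin 2 => if i.val + j.val + 1 = 2 then (1 : L) else 0) (IsCMField.complexConj_ne_one L) w hw g :
        ↥(unitaryGroupOfForm σw (placeForm (Matrix.of fun i j : Fin 2 => if i.val + j.val + 1 = 2 then (1 : L) else 0) w.1))) : GL (Fin 2) (w.1.adicCompletion L)) : Matrix (Fin 2) (Fin 2) (w.1.adicCompletion L)) :=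
    fun g => rfl
  have hσv : ∀ x, Valued.v (σw x) = Valued.v x := fun x => valued_galAdicCompletionMap (L := L) (IsCMField.complexConj L) hw x
  have hvα0 : Valued.v α ≠ 0 := (Valuation.ne_zero_iff _).2 hα0
  have hαα' : Valued.v α * Valued.v (σw α)⁻¹ = 1 := by
    rw [Valuation.map_inv, hσv, mul_inv_cancel₀ hvα0]
  have hK' : ∀ k ∈ K₂, ∀ i j, Valued.v (((E k : GL (Fin 2) (w.1.adicCompletion L)) : Matrix (Fin 2) (Fin 2) (w.1.adicCompletion L)) i j -
      (1 : Matrix (Fin 2) (Fin 2) (w.1.adicCompletion L)) i j) ≤ r := fun k hk i j => by rw [hEapply]; exact hK k hk i j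
  have hz' : ((E z : GL (Fin 2) (w.1.adicCompletion L)) : Matrix (Fin 2) (Fin 2) (w.1.adicCompletion L)) = β • (1 : Matrix (Fin 2) (Fin 2) (w.1.adicCompletion L)) := by
    rw [hEapply]; exact hz
  have ha' : ((E a : GL (Fin 2) (w.1.adicCompletion L)) : Matrix (Fin 2) (Fin 2) (w.1.adicCompletion L)) = diagonal ![α, (σw α)⁻¹] := by
    rw [hEapply]; exact ha
  -- the matrix of `h₂` read at `w`, and its characteristic polynomial `= charpoly (E (y δ.1 y⁻¹))`
  set M₂ : Matrix (Fin 2) (Fin 2) (w.1.adicCompletion L) := (((γH.1.val : GL (Fin 2) (LocalRing L v)) : Matrix (Fin 2) (Fin 2) (LocalRing L v)).map ev) with hM₂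
  have hN : M₂.charpoly = ((E (y * δ.1 * y⁻¹) : GL (Fin 2) (w.1.adicCompletion L)) : Matrix (Fin 2) (Fin 2) (w.1.adicCompletion L)).charpoly := by
    rw [map_mul, map_mul, map_inv, Units.val_mul, Units.val_mul, Matrix.coe_units_inv, Matrix.charpoly_units_conj, hEapply,
      charpoly_localNonsplitEquiv, ← hst.1.charpoly_eq, hM₂, Matrix.charpoly_map]
  have hlt := valuation_det_lt_trace_sq_of_charpoly_eq Valued.v E K₂ hr hK' hz' ha' hβ hvα0 hα1 hαα' hm hy hN
  have htrace : M₂.trace = ev ((γH.1.val : GL (Fin 2) (LocalRing L v)) : Matrix (Fin 2) (Fin 2) (LocalRing L v)).trace := by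
    rw [hM₂, Matrix.trace, Matrix.trace, map_sum]; rfl
  have hdet : M₂.det = ev ((γH.1.val : GL (Fin 2) (LocalRing L v)) : Matrix (Fin 2) (Fin 2) (LocalRing L v)).det := by
    rw [hM₂, ← RingHom.mapMatrix_apply, ← RingHom.map_det]
  rw [← htrace, ← hdet]
  exact hlt

end CM

end Summit.HodgeConjecture.HodgeConjecture.Cruxes.H413.F0P3cStCharTSOffStratumH
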